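import Summits.QuantumFields.YangMills.Theorems.LangevinControlUVFemtoCurvatureTwoPointDefs
import Summits.QuantumFields.YangMills.Theorems.LangevinControlUVFemtoCurvatureTwoPointStubMaxwellKernelBand
import Summits.QuantumFields.YangMills.Theorems.LangevinControlUVFemtoCurvatureTwoPointStubWickSquares
import Summits.QuantumFields.YangMills.Theorems.LangevinControlUVFemtoCurvatureTwoPointStubFieldStrengthCovariance

/-!
# Route `LangevinControlUV`, item `FemtoCurvatureTwoPoint` (stmt-QuantumFields-9363), line `generic-step-gamma-encoding`:
# reduction of the fixed-torus axis LOWER bound K2⁻ to Gaussian domination (GD-dom)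

Support file (`--supports stmt-QuantumFields-9363`), landed from the kernel-checked skeleton
`Cruxes/FemtoCurvatureTwoPoint/Lines/generic_step_gamma_encoding.lean` (§ Reductions, reshape c2) against the tree vocabulary
`…TwoPointDefs` and the LANDED stubs K1a `Theorems.FemtoCurvatureTwoPoint.stub_maxwellKernelBand` (p94229), W
`.stub_wickSquares` (p111302), F `.stub_fieldStrengthCovariance` (p110989):

* `axisLower_of : MaxwellKernelBand → AxisGaussianLower → AxisLowerFixedTorus` (K1a ∧ GD⁻ ⇒ K2⁻: `κ c₁² ≤ β² n⁸ Cov`);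
* `axisGaussianLower_of_domination : WickSquares → FieldStrengthCovariance → AxisGaussianDomination → AxisGaussianLower`
  (the reference-Gaussian covariance of the two squared field strengths is `2·(2K_L(ne₂))² = 8K_L(ne₂)²`);
* `axisLowerFixedTorus_of_domination : AxisGaussianDomination → AxisLowerFixedTorus` — the lower half of C⁺ from the ONE open
  core statement GD-dom (fixed-torus Gaussian domination from below, `L`-uniform `κ`, thresholds free).

An earlier submission (p116541, lead c2) bounced only for wrapping the three landed stubs in `*_holds` copies; here they are
cited directly.
-/

set_option autoImplicit false

noncomputable section

open scoped BigOperators Matrix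
open MeasureTheory Filter Topology ProbabilityTheory

namespace Summit.QuantumFields.YangMills.Cruxes.FemtoCurvatureTwoPoint.GenericStepGammaEncoding

open Literature.MathematicalPhysics.QuantumFieldTheory

/-- **K1a ∧ GD⁻ ⇒ K2⁻.** With `c₁ ≤ n⁴ K_L(ne₂)` (kernel band) and `κ K_L(ne₂)² ≤ β² Cov` (Gaussian
domination from below), `κ c₁² ≤ β² n⁸ Cov`: the fixed-torus axis lower bound with `c = κ c₁²` and
the thresholds of GD⁻. -/
theorem axisLower_of (hK : MaxwellKernelBand) (hGD : AxisGaussianLower) : AxisLowerFixedTorus := by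
  intro G _ _ _ _ _ _ hG r
  obtain ⟨c₁, C₁, hc₁, hband⟩ := hK
  obtain ⟨κ, hκ, hL⟩ := hGD G hG r
  classical
  -- per-torus thresholds, by choice (junk `0` at `L = 0`)
  have hB : ∀ L : ℕ, ∃ B : ℝ, ∀ (hL0 : L ≠ 0) (β : ℝ), B ≤ β →
      haveI : NeZero L := ⟨hL0⟩
      ∀ (n : ℕ), 1 ≤ n → 8 * n ≤ L →
        κ * (((2 * Literature.Probability.LatticeModels.torusGreen
                  (Pi.single (2 : Fin 4) ((n : ℕ) : ZMod L) : Fin 4 → ZMod L)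
                - Literature.Probability.LatticeModels.torusGreen
                  ((Pi.single (2 : Fin 4) ((n : ℕ) : ZMod L) : Fin 4 → ZMod L)
                    + Pi.single (0 : Fin 4) (1 : ZMod L))
                - Literature.Probability.LatticeModels.torusGreen
                  ((Pi.single (2 : Fin 4) ((n : ℕ) : ZMod L) : Fin 4 → ZMod L)
                    - Pi.single (0 : Fin 4) (1 : ZMod L)))
              + (2 * Literature.Probability.LatticeModels.torusGreen
                  (Pi.single (2 : Fin 4) ((n : ℕ) : ZMod L) : Fin 4 → ZMod L)
                - Literature.Probability.LatticeModels.torusGreen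
                  ((Pi.single (2 : Fin 4) ((n : ℕ) : ZMod L) : Fin 4 → ZMod L)
                    + Pi.single (1 : Fin 4) (1 : ZMod L))
                - Literature.Probability.LatticeModels.torusGreen
                  ((Pi.single (2 : Fin 4) ((n : ℕ) : ZMod L) : Fin 4 → ZMod L)
                    - Pi.single (1 : Fin 4) (1 : ZMod L)))) / 2) ^ 2
          ≤ β ^ 2 *
            (wilsonExpectation r.ρ β (fun U : GaugeConfig 4 L G =>
                ((r.N : ℝ) - (r.ρ (plaquetteHolonomy U 0 0 1)).trace.re) *
                  ((r.N : ℝ) - (r.ρ (plaquetteHolonomy U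
                    (Pi.single (2 : Fin 4) ((n : ℕ) : ZMod L)) 0 1)).trace.re))
              - wilsonExpectation r.ρ β (fun U : GaugeConfig 4 L G =>
                  (r.N : ℝ) - (r.ρ (plaquetteHolonomy U 0 0 1)).trace.re)
                * wilsonExpectation r.ρ β (fun U : GaugeConfig 4 L G =>
                  (r.N : ℝ) - (r.ρ (plaquetteHolonomy U
                    (Pi.single (2 : Fin 4) ((n : ℕ) : ZMod L)) 0 1)).trace.re)) := by
    intro L
    by_cases hL0 : L = 0
    · exact ⟨0, fun h => absurd hL0 h⟩
    · haveI : NeZero L := ⟨hL0⟩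
      obtain ⟨B, hB⟩ := hL L
      exact ⟨B, fun _ β hβ n hn h8 => hB β hβ n hn h8⟩
  choose B hB using hB
  refine ⟨B, κ * c₁ ^ 2, by positivity, ?_⟩
  intro L _ β hβ P E hP hE n hn h8
  subst hP hE
  have hgd := hB L (NeZero.ne L) β hβ n hn h8
  have hb := (hband L (Pi.single (0 : Fin 4) (1 : ZMod L)) (Pi.single (1 : Fin 4) (1 : ZMod L)) _
    rfl rfl rfl n hn h8).1
  simp only at hb hgd ⊢
  -- abbreviate kernel and covariance
  set Kn : ℝ := ((2 * Literature.Probability.LatticeModels.torusGreen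
                  (Pi.single (2 : Fin 4) ((n : ℕ) : ZMod L) : Fin 4 → ZMod L)
                - Literature.Probability.LatticeModels.torusGreen
                  ((Pi.single (2 : Fin 4) ((n : ℕ) : ZMod L) : Fin 4 → ZMod L)
                    + Pi.single (0 : Fin 4) (1 : ZMod L))
                - Literature.Probability.LatticeModels.torusGreen
                  ((Pi.single (2 : Fin 4) ((n : ℕ) : ZMod L) : Fin 4 → ZMod L)
                    - Pi.single (0 : Fin 4) (1 : ZMod L)))
              + (2 * Literature.Probability.LatticeModels.torusGreen
                  (Pi.single (2 : Fin 4) ((n : ℕ) : ZMod L) : Fin 4 → ZMod L)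
                - Literature.Probability.LatticeModels.torusGreen
                  ((Pi.single (2 : Fin 4) ((n : ℕ) : ZMod L) : Fin 4 → ZMod L)
                    + Pi.single (1 : Fin 4) (1 : ZMod L))
                - Literature.Probability.LatticeModels.torusGreen
                  ((Pi.single (2 : Fin 4) ((n : ℕ) : ZMod L) : Fin 4 → ZMod L)
                    - Pi.single (1 : Fin 4) (1 : ZMod L)))) / 2 with hKn
  set cv : ℝ := wilsonExpectation r.ρ β (fun U : GaugeConfig 4 L G =>
                ((r.N : ℝ) - (r.ρ (plaquetteHolonomy U 0 0 1)).trace.re) *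
                  ((r.N : ℝ) - (r.ρ (plaquetteHolonomy U
                    (Pi.single (2 : Fin 4) ((n : ℕ) : ZMod L)) 0 1)).trace.re))
              - wilsonExpectation r.ρ β (fun U : GaugeConfig 4 L G =>
                  (r.N : ℝ) - (r.ρ (plaquetteHolonomy U 0 0 1)).trace.re)
                * wilsonExpectation r.ρ β (fun U : GaugeConfig 4 L G =>
                  (r.N : ℝ) - (r.ρ (plaquetteHolonomy U
                    (Pi.single (2 : Fin 4) ((n : ℕ) : ZMod L)) 0 1)).trace.re) with hcv
  -- `c₁ ≤ n⁴ Kn` and `κ Kn² ≤ β² cv`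
  have hn4 : (0 : ℝ) ≤ (n : ℝ) ^ 4 := by positivity
  have h1 : c₁ ^ 2 ≤ ((n : ℝ) ^ 4 * Kn) ^ 2 := pow_le_pow_left₀ hc₁.le hb 2
  have h2 : κ * c₁ ^ 2 ≤ (n : ℝ) ^ 8 * (κ * Kn ^ 2) := by
    have : (n : ℝ) ^ 8 * (κ * Kn ^ 2) = κ * ((n : ℝ) ^ 4 * Kn) ^ 2 := by ring
    rw [this]
    exact mul_le_mul_of_nonneg_left h1 hκ.le
  have h3 : (n : ℝ) ^ 8 * (κ * Kn ^ 2) ≤ (n : ℝ) ^ 8 * (β ^ 2 * cv) :=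
    mul_le_mul_of_nonneg_left hgd (by positivity)
  calc κ * c₁ ^ 2 ≤ (n : ℝ) ^ 8 * (β ^ 2 * cv) := h2.trans h3
    _ = β ^ 2 * ((n : ℝ) ^ 8 * cv) := by ring


/-- **Glue W ∧ F ∧ GD-dom ⇒ GD⁻ (proved; reshape c2).** The reference-Gaussian covariance of the two
squared field strengths is `2 · (2 K_L(ne₂))² = 8 K_L(ne₂)²` (Wick, then the kernel identity at
`(x, y) = (ne₂, 0)`), so GD-dom with constant `κ` is GD⁻ with constant `8κ`. -/
theorem axisGaussianLower_of_domination (hW : WickSquares) (hF : FieldStrengthCovariance)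
    (hD : AxisGaussianDomination) : AxisGaussianLower := by
  intro G _ _ _ _ _ _ hG r
  obtain ⟨κ, hκ, hL⟩ := hD G hG r
  refine ⟨8 * κ, by positivity, fun L _ => ?_⟩
  obtain ⟨B, hB⟩ := hL L
  refine ⟨B, fun β hβ n hn h8 => ?_⟩
  -- the reference Gaussian data, by defining equations
  set S : Matrix (Edge 4 L) (Edge 4 L) ℝ := fun e e' => if e.2 = e'.2 then
      Literature.Probability.LatticeModels.torusGreen (e.1 - e'.1) else 0 with hS
  set u : (Fin 4 → ZMod L) → Edge 4 L → ℝ := fun x e =>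
      (if e = (x, (0 : Fin 4)) then (1 : ℝ) else 0)
      + (if e = (x + Pi.single (0 : Fin 4) (1 : ZMod L), (1 : Fin 4)) then 1 else 0)
      - (if e = (x + Pi.single (1 : Fin 4) (1 : ZMod L), (0 : Fin 4)) then 1 else 0)
      - (if e = (x, (1 : Fin 4)) then 1 else 0) with hu
  have hdom := hB β hβ S u rfl rfl n hn h8
  obtain ⟨hpsd, hker⟩ := hF L S u rfl rfl
  have hw := hW (Edge 4 L) S hpsd (u (Pi.single (2 : Fin 4) ((n : ℕ) : ZMod L))) (u 0)
  rw [hw, hker, sub_zero] at hdom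
  -- `κ · 2 · (2K)² = 8κ K²`
  convert hdom using 1
  ring

/-- **K2⁻ from the open core GD-dom alone**: `AxisGaussianDomination → AxisLowerFixedTorus`, by K1a (landed
`stub_maxwellKernelBand`), W (`stub_wickSquares`), F (`stub_fieldStrengthCovariance`) and the two glue lemmas above. -/
theorem axisLowerFixedTorus_of_domination : AxisGaussianDomination → AxisLowerFixedTorus := fun hD =>
  axisLower_of Summit.QuantumFields.YangMills.Theorems.FemtoCurvatureTwoPoint.stub_maxwellKernelBand
    (axisGaussianLower_of_domination
      Summit.QuantumFields.YangMills.Theorems.FemtoCurvatureTwoPoint.stub_wickSquares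
      Summit.QuantumFields.YangMills.Theorems.FemtoCurvatureTwoPoint.stub_fieldStrengthCovariance hD)

end Summit.QuantumFields.YangMills.Cruxes.FemtoCurvatureTwoPoint.GenericStepGammaEncoding

end
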